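/-
Copyright: cell `pub-balaban-gaps` (G2), seat ne6 (row NE7b), `prover-pub-balaban-gaps-ne6-g16-0`. Project licence.
-/
import Summits.QuantumFields.BalabanUV.T4Continuum.Spine.NE7b.CompactFibreWindowSUNRate
import Summits.QuantumFields.BalabanUV.T4Continuum.Spine.NE7b.LinkMassSU

/-!
# THE ONE-PLAQUETTE MASS OF `SU(N)` DECAYS AT PRINT's RATE `½·d(𝔤)`:
# `c·β^{−(N²−1)∕2} ≤ ∫ e^{−β·Re tr(1−V)} dHaar_{SU(N)}(V) ≤ C·β^{−(N²−1)∕2}` (`β ≥ 1`), `−log(·)∕log β → (N² − 1)∕2`, and the owner's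
# `linkMass` ∕ bare torus partition function quantified (row NE7b, node U5c; MODEL, [folklore]; census V39 of the cell `pub-balaban-gaps`)

Cell `pub-balaban-gaps` (G2 spine census) for the `pub-balaban` T⁴ crux NE7b (`T4WeightBudget.RelWeightBound`; NOT PRINTED, NOT PROVED).
Crux-route work under `Spine/NE7b/`; imports V29 `CompactFibreWindowSUNRate` (two-sided small-ball law of `SU(N)`, exponent `N² − 1`, from the tree's
[VaropoulosSaloffcosteCoulhon1993] Thm. V.4.1) and the OWNER lineage's `LinkMassSU` (`BarePartitionFnDecay.linkMass`, `BarePartitionFnNoFloor.partitionFn_T4_le`,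
F-ne7bp1-g103-2); no `def`, zero `sorry`, no `Prop` of Bałaban's minted, nothing of Bałaban's asserted.

THE LOCATED QUESTION (census V39).  The OWNER's finding F-ne7bp1-g103-2 (`BarePartitionFnDecay` ∕ `BarePartitionFnNoFloor` ∕ `LinkMassSU`) shows that the
bare Wilson partition function of Bałaban's `K`-th torus has NO K-uniform floor: `Z_K ≤ linkMass β ^ (2·L^{m+K})` with `linkMass β < 1` on `SU(N)` (`β > 0`,
`N ≥ 2`) — a qualitative decay.  V29∕V38 priced the WINDOW and the HALVED-ACTION letters at print's rate `½·d(𝔤)`.  QUESTION: is the one-plaquette mass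
ITSELF at that rate, i.e. is the one-plaquette free energy `−log ∫ e^{−β·Re tr(1−V)} dHaar = ½·(N² − 1)·log β + O(1)`, BOTH halves, and what does that make of
the owner's decay?

ANSWER (this file, [folklore]): YES.
* §1 `exists_haarReal_sball_le_all` — V29's upper law at ALL radii: `∃ C ≥ 1, ∀ η > 0, Haar_{SU(N)}{‖V − 1‖_HS ≤ η} ≤ C·η^{N²−1}`.
* §2 `exp_neg_le_shellSum` — the pointwise SHELL BOUND `e^{−x} ≤ Σ_{j<k} e^{−j}·𝟙{x ≤ j + 1} + e^{−k}` (`x ≥ 0`, any `k`), and its integrated form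
  `plaquetteMass_le_shellSum`: `∫ e^{−β·Re tr(1−V)} ≤ Σ_{j<k} e^{−j}·Haar{Re tr(1−V) ≤ (j+1)∕β} + e^{−k}`.
* §3 **`exists_plaquetteMass_le`** — the UPPER half `∫ e^{−β·Re tr(1−V)} dHaar ≤ C′·((√β)⁻¹)^{N²−1}` for `β ≥ 1` (shells of width `1∕β`, the window law on each,
  `(j+1)^d·e^{−j} ≤ 4^d·d!·e^{½}·e^{−j∕2}`, a geometric sum `≤ 3`, and any `k ≥ (d∕2)·log β` shells); **`exists_le_plaquetteMass`** — the LOWER half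
  `c·((√β)⁻¹)^{N²−1} ≤ ∫ e^{−β·Re tr(1−V)} dHaar` (restrict to the window of radius `β^{−1∕2}`, where `β·Re tr(1−V) ≤ ½`);
  **`exists_abs_neg_log_plaquetteMass_sub_le`** (`|−log ∫ e^{−β·Re tr(1−V)} dHaar − ((N² − 1)∕2)·log β| ≤ c₁`, `β ≥ 1`) and the RATE
  **`tendsto_neg_log_plaquetteMass_div_log`** (`→ (N² − 1)∕2` as `β → ∞`).
* §4 THE OWNER's CURRENCY (`GaugeGroup.reTr = Re Tr∕N`, `HaarData.haar = haarProbability`): `linkMass_SU_eq` (`linkMass β = ∫ e^{−(β∕N)·Re tr(1−V)} dHaar`),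
  **`exists_linkMass_SU_le`** (`linkMass β ≤ C′·((√(β∕N))⁻¹)^{N²−1}` for `β ≥ N`) and **`partitionFn_T4_le_rate`**: the bare Wilson partition function of
  Bałaban's `K`-th torus satisfies `Z_K(β) ≤ (C′·(√(β∕N))⁻¹^{N²−1})^{2·L^{m+K}}` (`β ≥ N`) — F-ne7bp1-g103-2's «no floor» at print's RATE.
* §5 Sanity (`N = 2`: exponent `3`, i.e. `β^{−3∕2}`).

HONEST REMARKS.  (i) MODEL ∕ [folklore]: ONE plaquette variable under Haar, and the BARE Wilson measure's normalisation; constants SOFT (V29's existential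
two-sided constant; the refuter's quadrature NE7bREF-G99-POST3 reads the sharp constant of the halved-action ratio as `1` for `N = 2, 3` — not proved here).
(ii) The lower half in print's windowed currency (`z` of [B12] (0.15): `log z ≥ (N² − 1)·log g − C_z`) is ALREADY the tree's
`Literature…B16ZLower.log_zNorm_specialUnitaryGroup_ge` (pub-balaban pv24; window `χ{|u − 1| < ε₀}`, operator norm) — not duplicated; the UPPER half has no
reader's item in the tree (no `ZUpper`).  (iii) Nothing here touches the interacting measure beyond the owner's product bound `Z_K ≤ linkMass^{#family}`.
BY-NAME EFFECT ON THE WALL: NONE.  NE7b NOT PRINTED ∕ NOT PROVED; spine PROVED 0∕9; rung (B)+1 on ONE finite T⁴ — NOT infinite volume, NOT the mass gap, NOT Clay.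
HONEST DEPENDENCY: continuum YM on T⁴ ⇐ BetaPertH ∧ nine spine estimates (0/9 proved); BetaPertH ⇐ (D1) ∧ (D4) ∧ CAP+tail;
G-an2-4 gates asym, D1 and NE2/3/4.  This file changes none of it.
-/

set_option autoImplicit false

noncomputable section

open MeasureTheory Real Finset Set Filter Topology
open scoped Matrix.Norms.Frobenius ENNReal
open Literature.MathematicalPhysics.QuantumFieldTheory (haarProbability)
open Literature.MathematicalPhysics.QuantumFieldTheory.UnitaryCayley (re_trace_one_sub)
open Literature.MathematicalPhysics.QuantumFieldTheory.Balaban1983to89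
open Literature.MathematicalPhysics.QuantumFieldTheory.Balaban1983to89.Missing (partitionFn)
open Literature.MathematicalPhysics.QuantumFieldTheory.Balaban1983to89.T4Continuum (T4Family)
open Summit.QuantumFields.BalabanUV.T4Continuum.NE7b.CompactFibreWindowSUN (measurableSet_sball)
open Summit.QuantumFields.BalabanUV.T4Continuum.NE7b.CompactFibreWindowSUNRate (exists_haarReal_sball_two_sided traceWindow_eq_sball)
open Summit.QuantumFields.BalabanUV.T4Continuum.NE7b.BarePartitionFnDecay (plaqFactor linkMass linkMass_nonneg)
open Summit.QuantumFields.BalabanUV.T4Continuum.NE7b.BarePartitionFnNoFloor (partitionFn_T4_le)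

namespace Summit.QuantumFields.BalabanUV.T4Continuum.NE7b.CompactFibrePlaquetteMassSUN

variable {N : ℕ}

/-- §1 **UPPER SMALL-BALL LAW AT ALL RADII**: `∃ C ≥ 1, ∀ η > 0, Haar_{SU(N)}{‖V − 1‖_HS ≤ η} ≤ C·η^{N²−1}` (V29's law on `(0, 1]`; for `η > 1` the right side is `≥ C ≥ 1 ≥ Haar`). [folklore] -/
theorem exists_haarReal_sball_le_all : ∃ C : ℝ, 1 ≤ C ∧ ∀ η : ℝ, 0 < η →
    (haarProbability (Matrix.specialUnitaryGroup (Fin N) ℂ)).real {V : Matrix.specialUnitaryGroup (Fin N) ℂ | ‖(V : Matrix (Fin N) (Fin N) ℂ) - 1‖ ≤ η} ≤ C * η ^ (N ^ 2 - 1) := by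
  obtain ⟨C, hC, hlaw⟩ := exists_haarReal_sball_two_sided (N := N) one_pos
  refine ⟨C, hC, fun η hη => ?_⟩
  rcases le_or_gt η 1 with h1 | h1
  · exact (hlaw η hη h1).2
  · have hpow : 1 ≤ η ^ (N ^ 2 - 1) := one_le_pow₀ h1.le
    exact measureReal_le_one.trans (by nlinarith)

/-! ## §2 The shell bound -/

/-- **POINTWISE SHELL BOUND**: for `x ≥ 0` and every `k`, `e^{−x} ≤ Σ_{j<k} e^{−j}·𝟙{x ≤ j + 1} + e^{−k}` (if `x < k` the shell `j = ⌊x⌋ < k` contributes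
`e^{−⌊x⌋} ≥ e^{−x}`; otherwise `e^{−x} ≤ e^{−k}`). [folklore] -/
theorem exp_neg_le_shellSum {x : ℝ} (hx : 0 ≤ x) (k : ℕ) :
    Real.exp (-x) ≤ (∑ j ∈ Finset.range k, Real.exp (-(j : ℝ)) * (if x ≤ j + 1 then (1 : ℝ) else 0)) + Real.exp (-(k : ℝ)) := by
  have hsum0 : 0 ≤ ∑ j ∈ Finset.range k, Real.exp (-(j : ℝ)) * (if x ≤ j + 1 then (1 : ℝ) else 0) :=
    Finset.sum_nonneg fun j _ => mul_nonneg (Real.exp_pos _).le (by split_ifs <;> norm_num)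
  by_cases hk : (k : ℝ) ≤ x
  · have : Real.exp (-x) ≤ Real.exp (-(k : ℝ)) := Real.exp_le_exp.2 (by linarith)
    linarith
  · push Not at hk
    set j₀ : ℕ := ⌊x⌋₊ with hj₀
    have hfl : (j₀ : ℝ) ≤ x := Nat.floor_le hx
    have hlt : x < j₀ + 1 := Nat.lt_floor_add_one x
    have hj₀k : j₀ ∈ Finset.range k := by
      rw [Finset.mem_range]
      have : (j₀ : ℝ) < k := lt_of_le_of_lt hfl hk
      exact_mod_cast this
    have hterm : Real.exp (-x) ≤ Real.exp (-(j₀ : ℝ)) * (if x ≤ j₀ + 1 then (1 : ℝ) else 0) := by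
      rw [if_pos hlt.le, mul_one]; exact Real.exp_le_exp.2 (by linarith)
    have hsingle : Real.exp (-(j₀ : ℝ)) * (if x ≤ j₀ + 1 then (1 : ℝ) else 0) ≤ ∑ j ∈ Finset.range k, Real.exp (-(j : ℝ)) * (if x ≤ j + 1 then (1 : ℝ) else 0) :=
      Finset.single_le_sum (f := fun j : ℕ => Real.exp (-(j : ℝ)) * (if x ≤ j + 1 then (1 : ℝ) else 0))
        (fun j _ => mul_nonneg (Real.exp_pos _).le (by split_ifs <;> norm_num)) hj₀k
    linarith [Real.exp_pos (-(k : ℝ))]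

/-- **INTEGRATED SHELL BOUND**: for `β > 0` and every `k`,
`∫ e^{−β·Re tr(1−V)} dHaar ≤ Σ_{j<k} e^{−j}·Haar{Re tr(1 − V) ≤ (j+1)∕β} + e^{−k}`. [folklore] -/
theorem plaquetteMass_le_shellSum {β : ℝ} (hβ : 0 < β) (k : ℕ) :
    ∫ V, Real.exp (-(β * (Matrix.trace (1 - (V : Matrix (Fin N) (Fin N) ℂ))).re)) ∂(haarProbability (Matrix.specialUnitaryGroup (Fin N) ℂ))
      ≤ (∑ j ∈ Finset.range k, Real.exp (-(j : ℝ)) * (haarProbability (Matrix.specialUnitaryGroup (Fin N) ℂ)).real {V : Matrix.specialUnitaryGroup (Fin N) ℂ | (Matrix.trace (1 - (V : Matrix (Fin N) (Fin N) ℂ))).re ≤ (j + 1) / β})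
        + Real.exp (-(k : ℝ)) := by
  set μ := haarProbability (Matrix.specialUnitaryGroup (Fin N) ℂ) with hμ
  have hsm : Measurable fun V : Matrix.specialUnitaryGroup (Fin N) ℂ => (Matrix.trace (1 - (V : Matrix (Fin N) (Fin N) ℂ))).re :=
    (Complex.continuous_re.comp ((continuous_const.sub continuous_subtype_val).matrix_trace)).measurable
  have hs0 : ∀ V : Matrix.specialUnitaryGroup (Fin N) ℂ, 0 ≤ (Matrix.trace (1 - (V : Matrix (Fin N) (Fin N) ℂ))).re := fun V => by
    rw [re_trace_one_sub (Matrix.mem_specialUnitaryGroup_iff.1 V.2).1]; positivity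
  -- the shell indicator as a set indicator
  have hW : ∀ j : ℕ, MeasurableSet {V : Matrix.specialUnitaryGroup (Fin N) ℂ | (Matrix.trace (1 - (V : Matrix (Fin N) (Fin N) ℂ))).re ≤ (j + 1) / β} := fun j =>
    measurableSet_le hsm measurable_const
  have hind : ∀ (j : ℕ) (V : Matrix.specialUnitaryGroup (Fin N) ℂ),
      (if β * (Matrix.trace (1 - (V : Matrix (Fin N) (Fin N) ℂ))).re ≤ j + 1 then (1 : ℝ) else 0)
        = ({V : Matrix.specialUnitaryGroup (Fin N) ℂ | (Matrix.trace (1 - (V : Matrix (Fin N) (Fin N) ℂ))).re ≤ (j + 1) / β} : Set _).indicator 1 V := fun j V => by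
    have hiff : β * (Matrix.trace (1 - (V : Matrix (Fin N) (Fin N) ℂ))).re ≤ j + 1 ↔ (Matrix.trace (1 - (V : Matrix (Fin N) (Fin N) ℂ))).re ≤ (j + 1) / β := by
      rw [le_div_iff₀ hβ, mul_comm]
    simp only [Set.indicator_apply, Set.mem_setOf_eq, Pi.one_apply]
    by_cases hc : β * (Matrix.trace (1 - (V : Matrix (Fin N) (Fin N) ℂ))).re ≤ j + 1
    · rw [if_pos hc, if_pos (hiff.1 hc)]
    · rw [if_neg hc, if_neg fun h' => hc (hiff.2 h')]
  -- pointwise bound, then integrate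
  have hpt : ∀ V : Matrix.specialUnitaryGroup (Fin N) ℂ, Real.exp (-(β * (Matrix.trace (1 - (V : Matrix (Fin N) (Fin N) ℂ))).re))
      ≤ (∑ j ∈ Finset.range k, Real.exp (-(j : ℝ)) * ({V : Matrix.specialUnitaryGroup (Fin N) ℂ | (Matrix.trace (1 - (V : Matrix (Fin N) (Fin N) ℂ))).re ≤ (j + 1) / β} : Set _).indicator 1 V)
        + Real.exp (-(k : ℝ)) := fun V => by
    have h := exp_neg_le_shellSum (mul_nonneg hβ.le (hs0 V)) k
    simp_rw [hind] at h
    exact h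
  have hintj : ∀ j ∈ Finset.range k, Integrable (fun V : Matrix.specialUnitaryGroup (Fin N) ℂ =>
      Real.exp (-(j : ℝ)) * ({V : Matrix.specialUnitaryGroup (Fin N) ℂ | (Matrix.trace (1 - (V : Matrix (Fin N) (Fin N) ℂ))).re ≤ (j + 1) / β} : Set _).indicator 1 V) μ :=
    fun j _ => ((integrable_const (1 : ℝ)).indicator (hW j)).const_mul _
  have hintS : Integrable (fun V : Matrix.specialUnitaryGroup (Fin N) ℂ => ∑ j ∈ Finset.range k, Real.exp (-(j : ℝ)) * ({V : Matrix.specialUnitaryGroup (Fin N) ℂ | (Matrix.trace (1 - (V : Matrix (Fin N) (Fin N) ℂ))).re ≤ (j + 1) / β} : Set _).indicator 1 V) μ :=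
    integrable_finsetSum _ hintj
  have hintR : Integrable (fun V : Matrix.specialUnitaryGroup (Fin N) ℂ => (∑ j ∈ Finset.range k, Real.exp (-(j : ℝ)) * ({V : Matrix.specialUnitaryGroup (Fin N) ℂ | (Matrix.trace (1 - (V : Matrix (Fin N) (Fin N) ℂ))).re ≤ (j + 1) / β} : Set _).indicator 1 V)
      + Real.exp (-(k : ℝ))) μ := hintS.add (integrable_const _)
  have hintL : Integrable (fun V : Matrix.specialUnitaryGroup (Fin N) ℂ => Real.exp (-(β * (Matrix.trace (1 - (V : Matrix (Fin N) (Fin N) ℂ))).re))) μ :=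
    Integrable.of_bound ((Real.measurable_exp.comp ((hsm.const_mul β).neg)).aestronglyMeasurable) 1
      (ae_of_all _ fun V => by rw [Real.norm_eq_abs, abs_of_pos (Real.exp_pos _), Real.exp_le_one_iff]; nlinarith [hs0 V])
  have h1 := integral_mono hintL hintR hpt
  rw [integral_add hintS (integrable_const _), integral_const, probReal_univ, one_smul, integral_finsetSum _ hintj] at h1
  have hsum : ∑ j ∈ Finset.range k, ∫ V, Real.exp (-(j : ℝ)) * ({V : Matrix.specialUnitaryGroup (Fin N) ℂ | (Matrix.trace (1 - (V : Matrix (Fin N) (Fin N) ℂ))).re ≤ (j + 1) / β} : Set _).indicator 1 V ∂μ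
      = ∑ j ∈ Finset.range k, Real.exp (-(j : ℝ)) * μ.real {V : Matrix.specialUnitaryGroup (Fin N) ℂ | (Matrix.trace (1 - (V : Matrix (Fin N) (Fin N) ℂ))).re ≤ (j + 1) / β} :=
    Finset.sum_congr rfl fun j _ => by rw [integral_const_mul, integral_indicator_one (hW j)]
  rw [hsum] at h1
  exact h1

/-! ## §3 The two halves and the rate -/

/-- The arithmetic of the shells: `Σ_{j<k} e^{−j}·(√(2(j+1)))^d ≤ 3·4^d·d!·e^{½}` for every `k` (`(√y)^d ≤ y^d` for `y ≥ 1`; `(j+1)^d ≤ d!·2^d·e^{(j+1)∕2}` from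
`x^d∕d! ≤ e^x`; `Σ_j e^{−j∕2} ≤ 1∕(1 − e^{−½}) ≤ 3`). [folklore] -/
theorem shellSum_le (d k : ℕ) :
    ∑ j ∈ Finset.range k, Real.exp (-(j : ℝ)) * Real.sqrt (2 * ((j : ℝ) + 1)) ^ d ≤ 3 * 4 ^ d * (Nat.factorial d) * Real.exp (1 / 2) := by
  have hterm : ∀ j : ℕ, Real.exp (-(j : ℝ)) * Real.sqrt (2 * ((j : ℝ) + 1)) ^ d ≤ 4 ^ d * (Nat.factorial d) * Real.exp (1 / 2) * Real.exp (-(1 / 2 : ℝ)) ^ j := by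
    intro j
    have hy : (1 : ℝ) ≤ 2 * ((j : ℝ) + 1) := by have : (0 : ℝ) ≤ j := Nat.cast_nonneg j; linarith
    have hsq : Real.sqrt (2 * ((j : ℝ) + 1)) ≤ 2 * ((j : ℝ) + 1) := by
      have h1 : 1 ≤ Real.sqrt (2 * ((j : ℝ) + 1)) := Real.one_le_sqrt.2 hy
      calc Real.sqrt (2 * ((j : ℝ) + 1)) = Real.sqrt (2 * ((j : ℝ) + 1)) * 1 := (mul_one _).symm
        _ ≤ Real.sqrt (2 * ((j : ℝ) + 1)) * Real.sqrt (2 * ((j : ℝ) + 1)) := mul_le_mul_of_nonneg_left h1 (Real.sqrt_nonneg _)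
        _ = 2 * ((j : ℝ) + 1) := Real.mul_self_sqrt (by linarith)
    have hpow1 : Real.sqrt (2 * ((j : ℝ) + 1)) ^ d ≤ (2 * ((j : ℝ) + 1)) ^ d := pow_le_pow_left₀ (Real.sqrt_nonneg _) hsq d
    -- `(j+1)^d ≤ d!·2^d·e^{(j+1)/2}`
    have hfac : ((j : ℝ) + 1) ^ d ≤ (Nat.factorial d) * 2 ^ d * Real.exp (((j : ℝ) + 1) / 2) := by
      have h := Real.pow_div_factorial_le_exp (x := ((j : ℝ) + 1) / 2) (by positivity) d
      have hf : (0 : ℝ) < Nat.factorial d := by exact_mod_cast Nat.factorial_pos d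
      rw [div_pow, div_div, div_le_iff₀ (by positivity)] at h
      calc ((j : ℝ) + 1) ^ d ≤ Real.exp (((j : ℝ) + 1) / 2) * (2 ^ d * (Nat.factorial d)) := h
        _ = (Nat.factorial d) * 2 ^ d * Real.exp (((j : ℝ) + 1) / 2) := by ring
    have hexp : Real.exp (((j : ℝ) + 1) / 2) = Real.exp (1 / 2) * Real.exp (-(1 / 2 : ℝ)) ^ j * Real.exp (j : ℝ) := by
      rw [← Real.exp_nat_mul, ← Real.exp_add, ← Real.exp_add]; congr 1; ring
    calc Real.exp (-(j : ℝ)) * Real.sqrt (2 * ((j : ℝ) + 1)) ^ d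
        ≤ Real.exp (-(j : ℝ)) * (2 * ((j : ℝ) + 1)) ^ d := mul_le_mul_of_nonneg_left hpow1 (Real.exp_pos _).le
      _ = Real.exp (-(j : ℝ)) * 2 ^ d * ((j : ℝ) + 1) ^ d := by rw [mul_pow]; ring
      _ ≤ Real.exp (-(j : ℝ)) * 2 ^ d * ((Nat.factorial d) * 2 ^ d * Real.exp (((j : ℝ) + 1) / 2)) := mul_le_mul_of_nonneg_left hfac (by positivity)
      _ = 4 ^ d * (Nat.factorial d) * Real.exp (1 / 2) * Real.exp (-(1 / 2 : ℝ)) ^ j * (Real.exp (-(j : ℝ)) * Real.exp (j : ℝ)) := by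
          rw [hexp, show (4 : ℝ) ^ d = 2 ^ d * 2 ^ d by rw [← mul_pow]; norm_num]; ring
      _ = 4 ^ d * (Nat.factorial d) * Real.exp (1 / 2) * Real.exp (-(1 / 2 : ℝ)) ^ j := by rw [← Real.exp_add, neg_add_cancel, Real.exp_zero, mul_one]
  -- geometric sum `Σ_{j<k} (e^{−1/2})^j ≤ 1/(1 − e^{−1/2}) ≤ 3`
  have hr0 : 0 ≤ Real.exp (-(1 / 2 : ℝ)) := (Real.exp_pos _).le
  have hr1 : Real.exp (-(1 / 2 : ℝ)) ≤ 2 / 3 := by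
    have h := Real.add_one_le_exp (1 / 2 : ℝ)
    rw [Real.exp_neg, inv_le_comm₀ (Real.exp_pos _) (by norm_num)]
    linarith
  have hgeom : ∑ j ∈ Finset.range k, Real.exp (-(1 / 2 : ℝ)) ^ j ≤ 3 := by
    have h := geom_sum_Ico_le_of_lt_one (m := 0) (n := k) hr0 (by linarith)
    rw [← Finset.range_eq_Ico, pow_zero] at h
    calc ∑ j ∈ Finset.range k, Real.exp (-(1 / 2 : ℝ)) ^ j ≤ 1 / (1 - Real.exp (-(1 / 2 : ℝ))) := h
      _ ≤ 3 := by rw [div_le_iff₀ (by linarith)]; linarith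
  calc ∑ j ∈ Finset.range k, Real.exp (-(j : ℝ)) * Real.sqrt (2 * ((j : ℝ) + 1)) ^ d
      ≤ ∑ j ∈ Finset.range k, 4 ^ d * (Nat.factorial d) * Real.exp (1 / 2) * Real.exp (-(1 / 2 : ℝ)) ^ j := Finset.sum_le_sum fun j _ => hterm j
    _ = 4 ^ d * (Nat.factorial d) * Real.exp (1 / 2) * ∑ j ∈ Finset.range k, Real.exp (-(1 / 2 : ℝ)) ^ j := by rw [Finset.mul_sum]
    _ ≤ 4 ^ d * (Nat.factorial d) * Real.exp (1 / 2) * 3 := mul_le_mul_of_nonneg_left hgeom (by positivity)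
    _ = 3 * 4 ^ d * (Nat.factorial d) * Real.exp (1 / 2) := by ring

/-- `((√β)⁻¹)^d = exp(−(d∕2)·log β)` for `β > 0`. [folklore] -/
theorem inv_sqrt_pow_eq_exp {β : ℝ} (hβ : 0 < β) (d : ℕ) : (Real.sqrt β)⁻¹ ^ d = Real.exp (-((d : ℝ) / 2 * Real.log β)) := by
  have hs : 0 < Real.sqrt β := Real.sqrt_pos.2 hβ
  rw [← Real.exp_log hs, Real.log_sqrt hβ.le, ← Real.exp_neg, ← Real.exp_nat_mul]
  congr 1; ring

/-- **UPPER HALF OF THE ONE-PLAQUETTE RATE**: `∃ C′ > 0, ∀ β ≥ 1, ∫ e^{−β·Re tr(1−V)} dHaar_{SU(N)}(V) ≤ C′·((√β)⁻¹)^{N²−1}`. [folklore] -/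
theorem exists_plaquetteMass_le : ∃ C' : ℝ, 0 < C' ∧ ∀ β : ℝ, 1 ≤ β →
    ∫ V, Real.exp (-(β * (Matrix.trace (1 - (V : Matrix (Fin N) (Fin N) ℂ))).re)) ∂(haarProbability (Matrix.specialUnitaryGroup (Fin N) ℂ)) ≤ C' * (Real.sqrt β)⁻¹ ^ (N ^ 2 - 1) := by
  obtain ⟨C, hC, hlaw⟩ := exists_haarReal_sball_le_all (N := N)
  set d : ℕ := N ^ 2 - 1 with hd
  have hS0 : 0 ≤ C * (3 * 4 ^ d * (Nat.factorial d) * Real.exp (1 / 2)) :=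
    mul_nonneg (by linarith) (mul_nonneg (mul_nonneg (mul_nonneg (by norm_num) (pow_nonneg (by norm_num) d)) (Nat.cast_nonneg _)) (Real.exp_pos _).le)
  refine ⟨C * (3 * 4 ^ d * (Nat.factorial d) * Real.exp (1 / 2)) + 1, by linarith, fun β hβ => ?_⟩
  have hβ0 : 0 < β := by linarith
  have hsβ : 0 < Real.sqrt β := Real.sqrt_pos.2 hβ0
  set μ := haarProbability (Matrix.specialUnitaryGroup (Fin N) ℂ) with hμ
  -- number of shells: any natural `k ≥ (d/2)·log β`
  obtain ⟨k, hklog⟩ : ∃ k : ℕ, (d : ℝ) / 2 * Real.log β ≤ k := exists_nat_ge _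
  have hek : Real.exp (-(k : ℝ)) ≤ (Real.sqrt β)⁻¹ ^ d := by
    rw [inv_sqrt_pow_eq_exp hβ0]; exact Real.exp_le_exp.2 (by linarith)
  -- each shell mass by the window law
  have hshell : ∀ j : ℕ, μ.real {V : Matrix.specialUnitaryGroup (Fin N) ℂ | (Matrix.trace (1 - (V : Matrix (Fin N) (Fin N) ℂ))).re ≤ (j + 1) / β}
      ≤ C * (Real.sqrt (2 * ((j : ℝ) + 1)) ^ d * (Real.sqrt β)⁻¹ ^ d) := fun j => by
    have ht : (0 : ℝ) < ((j : ℝ) + 1) / β := by positivity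
    rw [traceWindow_eq_sball ht.le]
    have hr : Real.sqrt (2 * (((j : ℝ) + 1) / β)) = Real.sqrt (2 * ((j : ℝ) + 1)) * (Real.sqrt β)⁻¹ := by
      rw [show 2 * (((j : ℝ) + 1) / β) = (2 * ((j : ℝ) + 1)) / β by ring, Real.sqrt_div' _ hβ0.le, div_eq_mul_inv]
    have hpos : 0 < Real.sqrt (2 * (((j : ℝ) + 1) / β)) := Real.sqrt_pos.2 (by positivity)
    calc μ.real {V : Matrix.specialUnitaryGroup (Fin N) ℂ | ‖(V : Matrix (Fin N) (Fin N) ℂ) - 1‖ ≤ Real.sqrt (2 * (((j : ℝ) + 1) / β))}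
        ≤ C * Real.sqrt (2 * (((j : ℝ) + 1) / β)) ^ d := hlaw _ hpos
      _ = C * (Real.sqrt (2 * ((j : ℝ) + 1)) ^ d * (Real.sqrt β)⁻¹ ^ d) := by rw [hr, mul_pow]
  have h1 := plaquetteMass_le_shellSum (N := N) hβ0 k
  have h2 : (∑ j ∈ Finset.range k, Real.exp (-(j : ℝ)) * μ.real {V : Matrix.specialUnitaryGroup (Fin N) ℂ | (Matrix.trace (1 - (V : Matrix (Fin N) (Fin N) ℂ))).re ≤ (j + 1) / β}) + Real.exp (-(k : ℝ))
      ≤ (∑ j ∈ Finset.range k, Real.exp (-(j : ℝ)) * (C * (Real.sqrt (2 * ((j : ℝ) + 1)) ^ d * (Real.sqrt β)⁻¹ ^ d))) + (Real.sqrt β)⁻¹ ^ d :=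
    add_le_add (Finset.sum_le_sum fun j _ => mul_le_mul_of_nonneg_left (hshell j) (Real.exp_pos _).le) hek
  have h3 : (∑ j ∈ Finset.range k, Real.exp (-(j : ℝ)) * (C * (Real.sqrt (2 * ((j : ℝ) + 1)) ^ d * (Real.sqrt β)⁻¹ ^ d))) + (Real.sqrt β)⁻¹ ^ d
      = C * (Real.sqrt β)⁻¹ ^ d * (∑ j ∈ Finset.range k, Real.exp (-(j : ℝ)) * Real.sqrt (2 * ((j : ℝ) + 1)) ^ d) + (Real.sqrt β)⁻¹ ^ d := by
    rw [Finset.mul_sum]; congr 1; exact Finset.sum_congr rfl fun j _ => by ring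
  have hCp : 0 ≤ C * (Real.sqrt β)⁻¹ ^ d := mul_nonneg (zero_le_one.trans hC) (pow_nonneg (inv_nonneg.2 hsβ.le) d)
  have h4 : C * (Real.sqrt β)⁻¹ ^ d * (∑ j ∈ Finset.range k, Real.exp (-(j : ℝ)) * Real.sqrt (2 * ((j : ℝ) + 1)) ^ d)
      ≤ C * (Real.sqrt β)⁻¹ ^ d * (3 * 4 ^ d * (Nat.factorial d) * Real.exp (1 / 2)) := mul_le_mul_of_nonneg_left (shellSum_le d k) hCp
  have h5 : C * (Real.sqrt β)⁻¹ ^ d * (3 * 4 ^ d * (Nat.factorial d) * Real.exp (1 / 2)) + (Real.sqrt β)⁻¹ ^ d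
      = (C * (3 * 4 ^ d * (Nat.factorial d) * Real.exp (1 / 2)) + 1) * (Real.sqrt β)⁻¹ ^ d := by ring
  linarith [h1, h2, h3, h4, h5]

/-- **LOWER HALF OF THE ONE-PLAQUETTE RATE.**  There is `c > 0` with `c·((√β)⁻¹)^{N²−1} ≤ ∫ e^{−β·Re tr(1−V)} dHaar_{SU(N)}(V)` for all `β ≥ 1` (restrict the integral
to the Hilbert–Schmidt window of radius `β^{−1∕2} ≤ 2`, where `β·Re tr(1 − V) = β‖1 − V‖²∕2 ≤ ½`, and use V29's lower law) — i.e. the one-plaquette free energy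
`−log ∫ e^{−β·Re tr(1−V)} dHaar` is at most `½·(N² − 1)·log β + O(1)`. [folklore] -/
theorem exists_le_plaquetteMass : ∃ c : ℝ, 0 < c ∧ ∀ β : ℝ, 1 ≤ β →
    c * (Real.sqrt β)⁻¹ ^ (N ^ 2 - 1) ≤ ∫ V, Real.exp (-(β * (Matrix.trace (1 - (V : Matrix (Fin N) (Fin N) ℂ))).re)) ∂(haarProbability (Matrix.specialUnitaryGroup (Fin N) ℂ)) := by
  obtain ⟨C, hC, hlaw⟩ := exists_haarReal_sball_two_sided (N := N) two_pos
  have hC0 : 0 < C := by linarith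
  refine ⟨Real.exp (-(1 / 2 : ℝ)) * C⁻¹, by positivity, fun β hβ => ?_⟩
  set μ := haarProbability (Matrix.specialUnitaryGroup (Fin N) ℂ) with hμ
  set d : ℕ := N ^ 2 - 1 with hd
  have hβ0 : 0 < β := by linarith
  set η : ℝ := (Real.sqrt β)⁻¹ with hη
  have hsβ : 0 < Real.sqrt β := Real.sqrt_pos.2 hβ0
  have hη0 : 0 < η := inv_pos.2 hsβ
  have hη2 : η ≤ 2 := by
    rw [hη]
    have h1 : 1 ≤ Real.sqrt β := by rw [show (1 : ℝ) = Real.sqrt 1 from Real.sqrt_one.symm]; exact Real.sqrt_le_sqrt hβ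
    calc (Real.sqrt β)⁻¹ ≤ 1 := inv_le_one_of_one_le₀ h1
      _ ≤ 2 := by norm_num
  have hη2β : β * η ^ 2 = 1 := by rw [hη, inv_pow, Real.sq_sqrt hβ0.le, mul_inv_cancel₀ hβ0.ne']
  set W : Set (Matrix.specialUnitaryGroup (Fin N) ℂ) := {V | ‖(V : Matrix (Fin N) (Fin N) ℂ) - 1‖ ≤ η} with hW
  have hWm : MeasurableSet W := measurableSet_sball η
  obtain ⟨hlow, -⟩ := hlaw η hη0 hη2
  -- the integrand is ≥ e^{-1/2} on the window
  have hint : Integrable (fun V : Matrix.specialUnitaryGroup (Fin N) ℂ => Real.exp (-(β * (Matrix.trace (1 - (V : Matrix (Fin N) (Fin N) ℂ))).re))) μ :=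
    Integrable.of_bound ((Real.measurable_exp.comp (((Complex.continuous_re.comp ((continuous_const.sub continuous_subtype_val).matrix_trace)).measurable.const_mul β).neg)).aestronglyMeasurable) 1
      (ae_of_all _ fun V => by
        rw [Real.norm_eq_abs, abs_of_pos (Real.exp_pos _), Real.exp_le_one_iff]
        have : 0 ≤ (Matrix.trace (1 - (V : Matrix (Fin N) (Fin N) ℂ))).re := by
          rw [re_trace_one_sub (Matrix.mem_specialUnitaryGroup_iff.1 V.2).1]; positivity
        nlinarith)
  have hstep1 : ∫ V in W, Real.exp (-(1 / 2 : ℝ)) ∂μ ≤ ∫ V in W, Real.exp (-(β * (Matrix.trace (1 - (V : Matrix (Fin N) (Fin N) ℂ))).re)) ∂μ := by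
    refine setIntegral_mono_on (integrableOn_const (measure_ne_top _ _)) hint.integrableOn hWm fun V hV => ?_
    have hU : (V : Matrix (Fin N) (Fin N) ℂ) ∈ Matrix.unitaryGroup (Fin N) ℂ := (Matrix.mem_specialUnitaryGroup_iff.1 V.2).1
    have htr : (Matrix.trace (1 - (V : Matrix (Fin N) (Fin N) ℂ))).re ≤ η ^ 2 / 2 := by
      rw [re_trace_one_sub hU, norm_sub_rev]
      have h := pow_le_pow_left₀ (norm_nonneg _) (show ‖(V : Matrix (Fin N) (Fin N) ℂ) - 1‖ ≤ η from hV) 2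
      linarith
    refine Real.exp_le_exp.2 ?_
    have : β * (Matrix.trace (1 - (V : Matrix (Fin N) (Fin N) ℂ))).re ≤ β * (η ^ 2 / 2) := mul_le_mul_of_nonneg_left htr hβ0.le
    rw [show β * (η ^ 2 / 2) = (β * η ^ 2) / 2 by ring, hη2β] at this
    linarith
  have hstep2 : ∫ V in W, Real.exp (-(β * (Matrix.trace (1 - (V : Matrix (Fin N) (Fin N) ℂ))).re)) ∂μ
      ≤ ∫ V, Real.exp (-(β * (Matrix.trace (1 - (V : Matrix (Fin N) (Fin N) ℂ))).re)) ∂μ :=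
    setIntegral_le_integral hint (ae_of_all _ fun V => (Real.exp_pos _).le)
  rw [setIntegral_const, smul_eq_mul] at hstep1
  calc Real.exp (-(1 / 2 : ℝ)) * C⁻¹ * (Real.sqrt β)⁻¹ ^ d = Real.exp (-(1 / 2 : ℝ)) * (C⁻¹ * η ^ d) := by rw [hη]; ring
    _ ≤ Real.exp (-(1 / 2 : ℝ)) * μ.real W := mul_le_mul_of_nonneg_left hlow (Real.exp_pos _).le
    _ = μ.real W * Real.exp (-(1 / 2 : ℝ)) := mul_comm _ _
    _ ≤ _ := hstep1.trans hstep2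

/-- **THE LOG PIN**: `∃ c₁, ∀ β ≥ 1, 0 < ∫ e^{−β·Re tr(1−V)} dHaar ∧ |−log ∫ e^{−β·Re tr(1−V)} dHaar − ((N² − 1)∕2)·log β| ≤ c₁` — the one-plaquette free energy is
`½·dim SU(N)·log β + O(1)`. [folklore] -/
theorem exists_abs_neg_log_plaquetteMass_sub_le : ∃ c₁ : ℝ, ∀ β : ℝ, 1 ≤ β →
    0 < ∫ V, Real.exp (-(β * (Matrix.trace (1 - (V : Matrix (Fin N) (Fin N) ℂ))).re)) ∂(haarProbability (Matrix.specialUnitaryGroup (Fin N) ℂ)) ∧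
    |-Real.log (∫ V, Real.exp (-(β * (Matrix.trace (1 - (V : Matrix (Fin N) (Fin N) ℂ))).re)) ∂(haarProbability (Matrix.specialUnitaryGroup (Fin N) ℂ))) - ((N ^ 2 - 1 : ℕ) : ℝ) / 2 * Real.log β|
      ≤ c₁ := by
  obtain ⟨c, hc, hlow⟩ := exists_le_plaquetteMass (N := N)
  obtain ⟨C', hC', hup⟩ := exists_plaquetteMass_le (N := N)
  set d : ℕ := N ^ 2 - 1 with hd
  refine ⟨max (Real.log C') (-Real.log c), fun β hβ => ?_⟩
  have hβ0 : 0 < β := by linarith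
  set z := ∫ V, Real.exp (-(β * (Matrix.trace (1 - (V : Matrix (Fin N) (Fin N) ℂ))).re)) ∂(haarProbability (Matrix.specialUnitaryGroup (Fin N) ℂ)) with hz
  have h1 := hlow β hβ
  have h2 := hup β hβ
  have hp : 0 < (Real.sqrt β)⁻¹ ^ d := pow_pos (inv_pos.2 (Real.sqrt_pos.2 hβ0)) d
  have hzpos : 0 < z := lt_of_lt_of_le (mul_pos hc hp) h1
  have hlogp : Real.log ((Real.sqrt β)⁻¹ ^ d) = -((d : ℝ) / 2 * Real.log β) := by rw [inv_sqrt_pow_eq_exp hβ0, Real.log_exp]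
  have hl1 := Real.log_le_log (mul_pos hc hp) h1
  have hl2 := Real.log_le_log hzpos h2
  rw [Real.log_mul hc.ne' hp.ne', hlogp] at hl1
  rw [Real.log_mul hC'.ne' hp.ne', hlogp] at hl2
  refine ⟨hzpos, abs_le.2 ⟨?_, ?_⟩⟩
  · have : Real.log C' ≤ max (Real.log C') (-Real.log c) := le_max_left _ _
    linarith
  · have : -Real.log c ≤ max (Real.log C') (-Real.log c) := le_max_right _ _
    linarith

/-- A squeeze in `log β`: if `|f(β) − a·log β| ≤ c` for `β ≥ 1` then `f(β)∕log β → a` as `β → ∞`. [folklore] -/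
theorem tendsto_div_log_of_abs_sub_le {f : ℝ → ℝ} {a c : ℝ} (h : ∀ β : ℝ, 1 ≤ β → |f β - a * Real.log β| ≤ c) :
    Tendsto (fun β : ℝ => f β / Real.log β) atTop (𝓝 a) := by
  have hL : Tendsto (fun β : ℝ => Real.log β) atTop atTop := Real.tendsto_log_atTop
  have hup : Tendsto (fun β : ℝ => a + c / Real.log β) atTop (𝓝 a) := by simpa using tendsto_const_nhds.add (tendsto_const_nhds.div_atTop hL)
  have hlow : Tendsto (fun β : ℝ => a - c / Real.log β) atTop (𝓝 a) := by simpa using tendsto_const_nhds.sub (tendsto_const_nhds.div_atTop hL)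
  have hev : ∀ᶠ β in atTop, (1 : ℝ) ≤ β ∧ 1 < Real.log β := (eventually_ge_atTop 1).and (hL.eventually_gt_atTop 1)
  refine tendsto_of_tendsto_of_tendsto_of_le_of_le' hlow hup ?_ ?_
  · filter_upwards [hev] with β hβ
    obtain ⟨hβ1, hL1⟩ := hβ
    have hLpos : 0 < Real.log β := by linarith
    have hb := (abs_le.1 (h β hβ1)).1
    rw [le_div_iff₀ hLpos, sub_mul, div_mul_cancel₀ _ hLpos.ne']; linarith
  · filter_upwards [hev] with β hβ
    obtain ⟨hβ1, hL1⟩ := hβ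
    have hLpos : 0 < Real.log β := by linarith
    have hb := (abs_le.1 (h β hβ1)).2
    rw [div_le_iff₀ hLpos, add_mul, div_mul_cancel₀ _ hLpos.ne']; linarith

/-- **THE RATE: `−log ∫ e^{−β·Re tr(1−V)} dHaar_{SU(N)} ∕ log β → (N² − 1)∕2 = ½·dim SU(N)`** as `β → ∞`. [folklore] -/
theorem tendsto_neg_log_plaquetteMass_div_log :
    Tendsto (fun β : ℝ => -Real.log (∫ V, Real.exp (-(β * (Matrix.trace (1 - (V : Matrix (Fin N) (Fin N) ℂ))).re)) ∂(haarProbability (Matrix.specialUnitaryGroup (Fin N) ℂ))) / Real.log β)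
      atTop (𝓝 (((N ^ 2 - 1 : ℕ) : ℝ) / 2)) := by
  obtain ⟨c₁, h⟩ := exists_abs_neg_log_plaquetteMass_sub_le (N := N)
  exact tendsto_div_log_of_abs_sub_le fun β hβ => (h β hβ).2

/-! ## §4 The OWNER's currency: `linkMass` on `SU(N)` and the bare torus partition function at print's rate -/

section Owner

/-- On `SU(N)` (`N ≥ 1`) the owner's single-plaquette factor is `e^{−(β∕N)·Re tr(1−V)}` (`GaugeGroup.reTr = Re Tr∕N`). [folklore] -/
theorem plaqFactor_SU_eq [NeZero N] (β : ℝ) (V : Matrix.specialUnitaryGroup (Fin N) ℂ) :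
    plaqFactor β V = Real.exp (-(β / N * (Matrix.trace (1 - (V : Matrix (Fin N) (Fin N) ℂ))).re)) := by
  have hN : (N : ℝ) ≠ 0 := Nat.cast_ne_zero.2 (NeZero.ne N)
  rw [plaqFactor, show GaugeGroup.reTr V = UnitaryModel.nReTr (V : Matrix (Fin N) (Fin N) ℂ) from rfl, UnitaryModel.nReTr, Fintype.card_fin,
    Matrix.trace_sub, Matrix.trace_one, Complex.sub_re, Fintype.card_fin, Complex.natCast_re]
  congr 1
  field_simp

/-- `linkMass β = ∫ e^{−(β∕N)·Re tr(1−V)} dHaar_{SU(N)}` (`HaarData.haar = haarProbability` on `SU(N)`). [folklore] -/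
theorem linkMass_SU_eq [NeZero N] (β : ℝ) :
    linkMass (G := Matrix.specialUnitaryGroup (Fin N) ℂ) β = ∫ V, Real.exp (-(β / N * (Matrix.trace (1 - (V : Matrix (Fin N) (Fin N) ℂ))).re)) ∂(haarProbability (Matrix.specialUnitaryGroup (Fin N) ℂ)) := by
  rw [linkMass, show (HaarData.haar : Measure (Matrix.specialUnitaryGroup (Fin N) ℂ)) = haarProbability (Matrix.specialUnitaryGroup (Fin N) ℂ) from rfl]
  exact integral_congr_ae (ae_of_all _ fun V => plaqFactor_SU_eq β V)

/-- **THE OWNER's SINGLE-PLAQUETTE MASS AT PRINT's RATE**: `∃ C′ > 0, ∀ β ≥ N, linkMass β ≤ C′·((√(β∕N))⁻¹)^{N²−1}` on `SU(N)`, `N ≥ 1` — `LinkMassSU.linkMass_SU_lt_one`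
(`< 1`) quantified to the decay `β^{−(N²−1)∕2}`. [folklore] -/
theorem exists_linkMass_SU_le [NeZero N] : ∃ C' : ℝ, 0 < C' ∧ ∀ β : ℝ, (N : ℝ) ≤ β →
    linkMass (G := Matrix.specialUnitaryGroup (Fin N) ℂ) β ≤ C' * (Real.sqrt (β / N))⁻¹ ^ (N ^ 2 - 1) := by
  obtain ⟨C', hC', h⟩ := exists_plaquetteMass_le (N := N)
  have hN : (0 : ℝ) < N := Nat.cast_pos.2 (Nat.pos_of_ne_zero (NeZero.ne N))
  refine ⟨C', hC', fun β hβ => ?_⟩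
  rw [linkMass_SU_eq]
  exact h (β / N) ((one_le_div hN).2 hβ)

variable {F : T4Family}

/-- **F-ne7bp1-g103-2 AT PRINT's RATE**: the bare Wilson partition function of Bałaban's `K`-th torus with gauge group `SU(N)` (`N ≥ 1`) satisfies
`Z_K(β) ≤ (C′·((√(β∕N))⁻¹)^{N²−1})^{2·L^{m+K}}` for `β ≥ N` (the owner's `partitionFn_T4_le` composed with `exists_linkMass_SU_le`). [folklore] -/
theorem partitionFn_T4_le_rate [NeZero N] : ∃ C' : ℝ, 0 < C' ∧ ∀ (K : ℕ) (β : ℝ), (N : ℝ) ≤ β →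
    partitionFn (G := Matrix.specialUnitaryGroup (Fin N) ℂ) (F.P K) β ≤ (C' * (Real.sqrt (β / N))⁻¹ ^ (N ^ 2 - 1)) ^ (2 * F.L ^ (F.m + K)) := by
  obtain ⟨C', hC', h⟩ := exists_linkMass_SU_le (N := N)
  refine ⟨C', hC', fun K β hβ => ?_⟩
  have hβ0 : 0 ≤ β := (Nat.cast_nonneg N).trans hβ
  exact (partitionFn_T4_le K hβ0).trans (pow_le_pow_left₀ (linkMass_nonneg β) (h β hβ) _)

end Owner

/-- §5 Sanity, `SU(2)`: `∫ e^{−β·Re tr(1−V)} dHaar ≤ C′·(√β)⁻¹^3 = C′·β^{−3∕2}` for `β ≥ 1`. [folklore] -/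
example : ∃ C' : ℝ, 0 < C' ∧ ∀ β : ℝ, 1 ≤ β →
    ∫ V, Real.exp (-(β * (Matrix.trace (1 - (V : Matrix (Fin 2) (Fin 2) ℂ))).re)) ∂(haarProbability (Matrix.specialUnitaryGroup (Fin 2) ℂ)) ≤ C' * (Real.sqrt β)⁻¹ ^ 3 :=
  exists_plaquetteMass_le (N := 2)

end Summit.QuantumFields.BalabanUV.T4Continuum.NE7b.CompactFibrePlaquetteMassSUN

end
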